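import Summits.QuantumFields.BalabanUV.Beta.GAN24.ExitFaceWeightTransport
import Summits.QuantumFields.BalabanUV.Beta.GAN24.TransportedWordTools

/-!
# `BalabanUV.Beta.GAN24.TransportedMixedLegCurrents` — binder row G-an2-4 ∕ (CONV-C), TRANSFER-III, the (III′) (C)-row's `hXF (l+1)` FACE TERMS (OWNER gan24-p1 g53's memo
# `M3-HXF-SIZING-g53.md` §1): **THE EXIT-ROW TWO-LEG CURRENTS OF A TRANSPORTED TABLE `𝒯S = Ψ̂_Sᵀ ∘ slotPsiS S ∘ Ψ̂_S` WITH A MULTIPLIER FREE LEG ARE THOSE OF `S` ITSELF — NO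
# HYPOTHESIS ON THE CURRENT** (the multiplier block of `Ψ̂_S` is the identity, so only the slot transport and ONE leg transport appear, and both are blind to exit-row weights:
# leaf-01 g87 L `ExitFaceWeightTransport` §2), the companion of g87 L §3 (FIELD free leg: the current of `𝒯S` is the slot transport of the current of `S`); plus **THE TRANSPORT COMMUTES
# WITH LEG TRANSPOSITION** (`trK (𝒯Z) = 𝒯(trK Z)`): leg-symmetric members stay symmetric, leg-antisymmetric members stay antisymmetric; hence **A LEG-SYMMETRIC LOCAL TABLE WHOSE
# EXIT-ROW CURRENTS ALL VANISH HAS A TRANSPORT WITH THE SAME PROPERTY, in both leg orders** — the `hnullL ∕ hnullR` sockets of leaf-06's `FaceWordNullSector.faceWord_eq_cellPairing_of_null`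
# for the TRANSPORTED symmetrised border (my A `SymFaceDataVHNull` supplies the untransported null).
# (G-an2-4 CRUX TEAM (2), leaf prover `b2b-balaban-gan24-formalise-leaf-01`, gen 88; journal [LEAF01-G88-INTENT-3])

NOT IN PRINT; OUR BOOKKEEPING ([folklore] BY NAME over g87 J `TransportedDivFree` §1–§2 (the same three steps with one transport fewer), g87 L `ExitFaceWeightTransport` §2–§3, d1-leaf-03's
`SymCorrectorSlot.comp_psiKS_inl_right ∕ comp_trK_psiKS_inr_left ∕ comp_psiKS_inr_right ∕ comp_trK_psiKS_inl_left`, `SymCorrectorSockets.locStencil_slotPsiS`, g84∕g86's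
`SymCorrectorZeroMode.tsum_slotPsiS_param ∕ summable_slotPsiS`, `SymCorrectorClassCurrent.mul_slotPsiS`, `TransportedWordTools.slotPsiS_antisymm`, an5's `TameKernelCalculus`
(`trK_comp ∕ comp_assoc_tame ∕ comp_neg_left ∕ comp_neg_right`); generic `d`, `0 < n`, `r ∈ box (d+1) n`; 0 `def`, 0 cited fact, 0 `def … : Prop`, 0 sorry).
HONEST FRAMING (cell contract, verbatim): «discharging `BetaPertH` makes Bałaban's UV stability UNCONDITIONAL — a real constructive-QFT result; it is NOT the continuum limit and NOT
the Clay problem.»  HONEST DEPENDENCY (verbatim): «continuum YM on T⁴ ⇐ BetaPertH ∧ nine spine estimates (0/9 proved); BetaPertH ⇐ (D1) ∧ (D4) ∧ CAP+tail; G-an2-4 gates asym, D1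
and NE2/3/4.»

## What is proved (`Ψ̂ = psiKS r n`, `𝒯S ν u := Ψ̂ᵀ ∘ slotPsiS r n S ν u ∘ Ψ̂`)
* §1 `transport_entry_inr_inl` (the `(inr m, inl β)` entry of `𝒯S ν u` as TWO nested scalar slot transports), `tsum_slot_transport_inr_inl` (the slot sum with a reweighting `σ′`),
  **`current_transport_inr_inl`** (leg and slot reweighted: the current of `𝒯S` with free multiplier first leg IS the reweighted current of `S`), **`exitRow_current_transport_inr_inl`**
  (exit-row-supported bounded weights: the transport is invisible).
* §2 `trK_transport`, `slotPsiS_symm_member`, **`transport_symm`** (leg-symmetric `S` ⟹ leg-symmetric `𝒯S`), **`transport_antisymm`** (leg-antisymmetric `S` ⟹ leg-antisymmetric `𝒯S`).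
* §3 **`exitRow_current_transport_eq_zero_fst`** (free leg first, every free leg `a : Fib d`: null currents of a local `S` ⟹ null currents of `𝒯S`) and
  **`exitRow_current_transport_eq_zero_snd`** (weighted leg first, free leg second; `S` leg-symmetric).
WHAT THIS IS NOT: no table of Bałaban's is evaluated; NEVER «G-an2-4 closed» as (CONV-C); NOT D1, NOT `BetaPertH`, NOT continuum, NOT Clay.  2026-08-27; no existing file touched.
-/

noncomputable section

open Finset
open scoped BigOperators
open Literature.MathematicalPhysics.QuantumFieldTheory
open Literature.MathematicalPhysics.QuantumFieldTheory.Balaban1983to89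
open Literature.MathematicalPhysics.QuantumFieldTheory.Balaban1983to89.Beta
open ExpKernelCalculus (Site MKer comp)
open OneStepResolventKernel (Fib LocStencil)
open AffineAveraging (Form1 box toSite unitVec)
open Summit.QuantumFields.BalabanUV.Beta.TameKernelCalculus (trK trK_apply trK_comp trK_trK Spr Loc comp_assoc_tame comp_neg_left comp_neg_right)
open Summit.QuantumFields.BalabanUV.Beta.SymCorrectorKernel (psiKS spr_psiKS)
open Summit.QuantumFields.BalabanUV.Beta.SymCorrectorFace (slotPsiS slotPsiS_apply_kernel slotPsiS_zero)
open Summit.QuantumFields.BalabanUV.Beta.SymCorrectorSockets (locStencil_slotPsiS)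
open Summit.QuantumFields.BalabanUV.Beta.SymCorrectorSlot (comp_psiKS_inl_right comp_trK_psiKS_inl_left comp_psiKS_inr_right comp_trK_psiKS_inr_left)
open Summit.QuantumFields.BalabanUV.Beta.GAN24.SymCorrectorZeroMode (tsum_slotPsiS_param summable_slotPsiS)
open Summit.QuantumFields.BalabanUV.Beta.GAN24.SlotTransportPeriodicWeight (summable_weight_mul)
open Summit.QuantumFields.BalabanUV.Beta.GAN24.ExitFaceCurrentSectorSplit (summable_slot_locStencil summable_leg_slot_locStencil)
open Summit.QuantumFields.BalabanUV.Beta.GAN24.SymCorrectorClassCurrent (mul_slotPsiS)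
open Summit.QuantumFields.BalabanUV.Beta.GAN24.TransportedWordTools (slotPsiS_antisymm)
open Summit.QuantumFields.BalabanUV.Beta.GAN24.ExitFaceWeightTransport (tsum_exitRow_mul_slotPsiS exitRow_current_transport_eq_slotPsiS)

namespace Summit.QuantumFields.BalabanUV.Beta.GAN24.TransportedMixedLegCurrents

variable {d : ℕ} {n : ℕ} (hn : 0 < n) {r : Fin (d + 1) → ℕ} (hr : r ∈ box (d + 1) n)

/-! ## §1 Currents with a free MULTIPLIER first leg: the transport is invisible -/

section Mixed

variable {S : Fin (d + 1) → Site (d + 1) → MKer (d + 1) (Fib d)} {Cs δs : ℝ}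

include hn hr

/-- [folklore] **THE `(inr m, inl β)` ENTRY OF THE TRANSPORTED TABLE AS TWO NESTED SCALAR SLOT TRANSPORTS**: `(Ψ̂ᵀ ∘ slotPsiS S ν u ∘ Ψ̂) v q (inr m)(inl β) =
slotPsiS_{(β,q)}[κ₂ w ↦ slotPsiS_{(ν,u)}[κ t ↦ S κ t v w (inr m)(inl κ₂)]]` — the left multiplier leg is untouched (`Ψ̂`'s multiplier block is the identity), the right field leg is the slot
transport of the row family (d1-leaf-03 TT3b). -/
theorem transport_entry_inr_inl (S : Fin (d + 1) → Site (d + 1) → MKer (d + 1) (Fib d)) (ν : Fin (d + 1)) (u v q : Site (d + 1)) (m β : Fin (d + 1)) :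
    comp (comp (trK (psiKS r n)) (slotPsiS r n S ν u)) (psiKS r n) v q (Sum.inr m) (Sum.inl β)
      = slotPsiS r n (fun κ₂ w => slotPsiS r n (fun κ t => S κ t v w (Sum.inr m) (Sum.inl κ₂)) ν u) β q := by
  rw [comp_psiKS_inl_right hn hr (comp (trK (psiKS r n)) (slotPsiS r n S ν u)) v q (Sum.inr m) β]
  congr 1
  funext κ₂ w
  rw [comp_trK_psiKS_inr_left (slotPsiS r n S ν u) v w m (Sum.inl κ₂)]
  exact slotPsiS_apply_kernel r n S ν u v w (Sum.inr m) (Sum.inl κ₂)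

/-- NOT IN PRINT; OUR BOOKKEEPING ([folklore]; THE SLOT).  For a local `S`, a bounded slot weight `σ` with slot-transport reweighting `σ′` and all `v q m β`:
`Σ'_u σ u·(𝒯S) ν u v q (inr m)(inl β) = slotPsiS_{(β,q)}[κ₂ w ↦ Σ'_u σ′ u·S ν u v w (inr m)(inl κ₂)]`. -/
theorem tsum_slot_transport_inr_inl (hS : LocStencil S Cs δs) (hδs : 0 < δs) {σ σ' : Site (d + 1) → ℝ} {Bσ : ℝ} (hσ : ∀ u, |σ u| ≤ Bσ) (ν : Fin (d + 1))
    (hσ' : ∀ T : Form1 (d + 1) ℝ, (∀ κ, Summable (T κ)) → ∑' u, σ u * slotPsiS r n T ν u = ∑' u, σ' u * T ν u)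
    (v q : Site (d + 1)) (m β : Fin (d + 1)) :
    ∑' u, σ u * comp (comp (trK (psiKS r n)) (slotPsiS r n S ν u)) (psiKS r n) v q (Sum.inr m) (Sum.inl β)
      = slotPsiS r n (fun κ₂ w => ∑' u, σ' u * S ν u v w (Sum.inr m) (Sum.inl κ₂)) β q := by
  have hT : ∀ (w : Site (d + 1)) (κ₂ κ : Fin (d + 1)), Summable fun t : Site (d + 1) => S κ t v w (Sum.inr m) (Sum.inl κ₂) := by
    intro w κ₂ κ
    have h := summable_slot_locStencil hS hδs (s := fun _ => (1 : ℝ)) (Bs := 1) (fun _ => by rw [abs_one]) κ v w (Sum.inr m) (Sum.inl κ₂)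
    simpa only [one_mul] using h
  have h0 : ∀ (w : Site (d + 1)) (κ₂ : Fin (d + 1)), Summable fun u : Site (d + 1) =>
      σ u * slotPsiS r n (fun κ t => S κ t v w (Sum.inr m) (Sum.inl κ₂)) ν u := fun w κ₂ =>
    summable_weight_mul hσ (summable_slotPsiS hn r (hT w κ₂) ν)
  rw [tsum_congr fun u => by rw [transport_entry_inr_inl hn hr S ν u v q m β, mul_slotPsiS]]
  rw [tsum_slotPsiS_param r (F := fun u => fun κ₂ w => σ u * slotPsiS r n (fun κ t => S κ t v w (Sum.inr m) (Sum.inl κ₂)) ν u) (fun κ₂ w => h0 w κ₂) β q]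
  congr 1
  funext κ₂ w
  exact hσ' (fun κ t => S κ t v w (Sum.inr m) (Sum.inl κ₂)) (hT w κ₂)

/-- NOT IN PRINT; OUR BOOKKEEPING ([folklore]; THE LEG).  **THE CURRENT OF `𝒯S` WITH FREE MULTIPLIER FIRST LEG IS THE REWEIGHTED CURRENT OF `S`**: for a local `S`, bounded weights `ρ σ` with
slot-transport reweightings `ρ′` (direction `β`) and `σ′` (direction `ν`, bounded), all `m v`:
`Σ'_q ρ q·Σ'_u σ u·(𝒯S) ν u v q (inr m)(inl β) = Σ'_q ρ′ q·Σ'_u σ′ u·S ν u v q (inr m)(inl β)` — NO transport is left. -/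
theorem current_transport_inr_inl (hS : LocStencil S Cs δs) (hδs : 0 < δs) {ρ ρ' σ σ' : Site (d + 1) → ℝ} {Bσ Bσ' : ℝ}
    (hσ : ∀ u, |σ u| ≤ Bσ) (hσ'b : ∀ u, |σ' u| ≤ Bσ') (ν β : Fin (d + 1))
    (hσ' : ∀ T : Form1 (d + 1) ℝ, (∀ κ, Summable (T κ)) → ∑' u, σ u * slotPsiS r n T ν u = ∑' u, σ' u * T ν u)
    (hρ' : ∀ T : Form1 (d + 1) ℝ, (∀ κ, Summable (T κ)) → ∑' q, ρ q * slotPsiS r n T β q = ∑' q, ρ' q * T β q)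
    (m : Fin (d + 1)) (v : Site (d + 1)) :
    ∑' q, ρ q * ∑' u, σ u * comp (comp (trK (psiKS r n)) (slotPsiS r n S ν u)) (psiKS r n) v q (Sum.inr m) (Sum.inl β)
      = ∑' q, ρ' q * ∑' u, σ' u * S ν u v q (Sum.inr m) (Sum.inl β) := by
  rw [tsum_congr fun q => by rw [tsum_slot_transport_inr_inl hn hr hS hδs hσ ν hσ' v q m β]]
  have hK : ∀ κ₂ : Fin (d + 1), Summable fun w : Site (d + 1) => ∑' u, σ' u * S ν u v w (Sum.inr m) (Sum.inl κ₂) := by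
    intro κ₂
    have h := summable_leg_slot_locStencil hS hδs (h := fun _ => (1 : ℝ)) (Bh := 1) (fun _ => by rw [abs_one]) hσ'b ν v (Sum.inr m) (Sum.inl κ₂)
    simpa only [one_mul] using h
  exact hρ' (fun κ₂ w => ∑' u, σ' u * S ν u v w (Sum.inr m) (Sum.inl κ₂)) hK

/-- NOT IN PRINT; OUR BOOKKEEPING ([folklore]).  **EXIT-ROW WEIGHTS: THE TRANSPORT IS INVISIBLE ON CURRENTS WITH A FREE MULTIPLIER FIRST LEG**: for a local `S` and bounded `f g : ℤ → ℝ` supported on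
`{k ≡ −1 (mod n)}` (every exit-face indicator of period `n·P`), all `ν β m v`:
`Σ'_q f(q_β)·Σ'_u g(u_ν)·(𝒯S) ν u v q (inr m)(inl β) = Σ'_q f(q_β)·Σ'_u g(u_ν)·S ν u v q (inr m)(inl β)` (§1 with g87 L §2). -/
theorem exitRow_current_transport_inr_inl (hS : LocStencil S Cs δs) (hδs : 0 < δs) {f g : ℤ → ℝ} {Bf Bg : ℝ} (hfb : ∀ k, |f k| ≤ Bf) (hgb : ∀ k, |g k| ≤ Bg)
    (hf : ∀ k, f k ≠ 0 → k % (n : ℤ) = (n : ℤ) - 1) (hg : ∀ k, g k ≠ 0 → k % (n : ℤ) = (n : ℤ) - 1) (ν β m : Fin (d + 1)) (v : Site (d + 1)) :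
    ∑' q : Site (d + 1), f (q β) * ∑' u : Site (d + 1), g (u ν) * comp (comp (trK (psiKS r n)) (slotPsiS r n S ν u)) (psiKS r n) v q (Sum.inr m) (Sum.inl β)
      = ∑' q : Site (d + 1), f (q β) * ∑' u : Site (d + 1), g (u ν) * S ν u v q (Sum.inr m) (Sum.inl β) :=
  current_transport_inr_inl hn hr hS hδs (ρ := fun q => f (q β)) (ρ' := fun q => f (q β)) (σ := fun u => g (u ν)) (σ' := fun u => g (u ν))
    (fun u => hgb (u ν)) (fun u => hgb (u ν)) ν β
    (fun _ hT => tsum_exitRow_mul_slotPsiS hn hr hT hgb hg ν) (fun _ hT => tsum_exitRow_mul_slotPsiS hn hr hT hfb hf β) m v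

end Mixed

/-! ## §2 The transport commutes with leg transposition -/

section Transpose

include hn hr

/-- [folklore] **`trK (Ψ̂ᵀ ∘ Z ∘ Ψ̂) = Ψ̂ᵀ ∘ trK Z ∘ Ψ̂`** for a localised `Z` (an5's `trK_comp` twice and `comp_assoc_tame`). -/
theorem trK_transport {Z : MKer (d + 1) (Fib d)} (hZ : Loc Z) :
    trK (comp (comp (trK (psiKS r n)) Z) (psiKS r n)) = comp (comp (trK (psiKS r n)) (trK Z)) (psiKS r n) := by
  have hΨ : Spr (psiKS r n) := spr_psiKS hn hr
  rw [trK_comp, trK_comp, trK_trK, comp_assoc_tame hΨ.trK.tame hZ.trK.tame hΨ.tame]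

omit hn hr in
/-- [folklore] **LEG SYMMETRY PASSES THE SLOT TRANSPORT** (`slotPsiS` is a linear combination of the members at the same legs). -/
theorem slotPsiS_symm_member {T : Fin (d + 1) → Site (d + 1) → MKer (d + 1) (Fib d)} (hT : ∀ (κ : Fin (d + 1)) (u x z : Site (d + 1)) (a b : Fib d), T κ u z x b a = T κ u x z a b)
    (κ : Fin (d + 1)) (u x z : Site (d + 1)) (a b : Fib d) : slotPsiS r n T κ u z x b a = slotPsiS r n T κ u x z a b := by
  rw [slotPsiS_apply_kernel, slotPsiS_apply_kernel]
  have e : (fun κ' u' => T κ' u' z x b a) = (fun κ' u' => T κ' u' x z a b) := by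
    funext κ' u'
    exact hT κ' u' x z a b
  rw [e]

/-- NOT IN PRINT; OUR BOOKKEEPING ([folklore]).  **A LEG-SYMMETRIC LOCAL TABLE HAS A LEG-SYMMETRIC TRANSPORT**: `(𝒯S κ u) z x b a = (𝒯S κ u) x z a b`. -/
theorem transport_symm {S : Fin (d + 1) → Site (d + 1) → MKer (d + 1) (Fib d)} {Cs δs : ℝ} (hS : LocStencil S Cs δs) (hδs : 0 < δs)
    (hsym : ∀ (κ : Fin (d + 1)) (u x z : Site (d + 1)) (a b : Fib d), S κ u z x b a = S κ u x z a b)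
    (κ : Fin (d + 1)) (u x z : Site (d + 1)) (a b : Fib d) :
    comp (comp (trK (psiKS r n)) (slotPsiS r n S κ u)) (psiKS r n) z x b a = comp (comp (trK (psiKS r n)) (slotPsiS r n S κ u)) (psiKS r n) x z a b := by
  have hT := locStencil_slotPsiS (d := d) hn r hS hδs.le
  have hL : Loc (slotPsiS r n S κ u) := ⟨u, u, _, _, hδs, hT κ u⟩
  have htr : trK (slotPsiS r n S κ u) = slotPsiS r n S κ u := by
    funext p q c e
    rw [trK_apply]
    exact slotPsiS_symm_member hsym κ u p q c e
  rw [← trK_apply (comp (comp (trK (psiKS r n)) (slotPsiS r n S κ u)) (psiKS r n)) x z a b, trK_transport hn hr hL, htr]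

/-- NOT IN PRINT; OUR BOOKKEEPING ([folklore]).  **A LEG-ANTISYMMETRIC LOCAL TABLE HAS A LEG-ANTISYMMETRIC TRANSPORT**: `(𝒯S κ u) z x b a = −(𝒯S κ u) x z a b` (g86 A1's `slotPsiS_antisymm`, then
`trK_transport` and `comp_neg_*`). -/
theorem transport_antisymm {S : Fin (d + 1) → Site (d + 1) → MKer (d + 1) (Fib d)} {Cs δs : ℝ} (hS : LocStencil S Cs δs) (hδs : 0 < δs)
    (hanti : ∀ (κ : Fin (d + 1)) (u x z : Site (d + 1)) (a b : Fib d), S κ u z x b a = -S κ u x z a b)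
    (κ : Fin (d + 1)) (u x z : Site (d + 1)) (a b : Fib d) :
    comp (comp (trK (psiKS r n)) (slotPsiS r n S κ u)) (psiKS r n) z x b a = -comp (comp (trK (psiKS r n)) (slotPsiS r n S κ u)) (psiKS r n) x z a b := by
  have hT := locStencil_slotPsiS (d := d) hn r hS hδs.le
  have hL : Loc (slotPsiS r n S κ u) := ⟨u, u, _, _, hδs, hT κ u⟩
  have htr : trK (slotPsiS r n S κ u) = -slotPsiS r n S κ u := by
    funext p q c e
    rw [trK_apply, Pi.neg_apply, Pi.neg_apply, Pi.neg_apply, Pi.neg_apply]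
    exact slotPsiS_antisymm r n hanti κ u p q c e
  rw [← trK_apply (comp (comp (trK (psiKS r n)) (slotPsiS r n S κ u)) (psiKS r n)) x z a b, trK_transport hn hr hL, htr, comp_neg_right, comp_neg_left]
  rfl

end Transpose

/-! ## §3 Null exit-row currents survive the transport (every free leg, both leg orders) -/

section Null

variable {S : Fin (d + 1) → Site (d + 1) → MKer (d + 1) (Fib d)} {Cs δs : ℝ}

include hn hr

/-- NOT IN PRINT; OUR BOOKKEEPING ([folklore]).  **FREE LEG FIRST**: for a local `S` and bounded exit-row-supported `f g`, if EVERY exit-row current of `S` with free first leg vanishes —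
`∀ a v, Σ'_q f(q_β)·Σ'_u g(u_ν)·S ν u v q a (inl β) = 0` — then so does every such current of `𝒯S` (field free leg: g87 L §3, the slot transport of the zero family; multiplier free leg: §1). -/
theorem exitRow_current_transport_eq_zero_fst (hS : LocStencil S Cs δs) (hδs : 0 < δs) {f g : ℤ → ℝ} {Bf Bg : ℝ} (hfb : ∀ k, |f k| ≤ Bf) (hgb : ∀ k, |g k| ≤ Bg)
    (hf : ∀ k, f k ≠ 0 → k % (n : ℤ) = (n : ℤ) - 1) (hg : ∀ k, g k ≠ 0 → k % (n : ℤ) = (n : ℤ) - 1) (ν β : Fin (d + 1))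
    (hnull : ∀ (a : Fib d) (v : Site (d + 1)), ∑' q : Site (d + 1), f (q β) * ∑' u : Site (d + 1), g (u ν) * S ν u v q a (Sum.inl β) = 0)
    (a : Fib d) (v : Site (d + 1)) :
    ∑' q : Site (d + 1), f (q β) * ∑' u : Site (d + 1), g (u ν) * comp (comp (trK (psiKS r n)) (slotPsiS r n S ν u)) (psiKS r n) v q a (Sum.inl β) = 0 := by
  rcases a with κ' | m
  · rw [exitRow_current_transport_eq_slotPsiS hn hr hS hδs hfb hgb hf hg ν β κ' v]
    have e : (fun (κ₁ : Fin (d + 1)) (y : Site (d + 1)) => ∑' q : Site (d + 1), f (q β) * ∑' u : Site (d + 1), g (u ν) * S ν u y q (Sum.inl κ₁) (Sum.inl β))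
        = (0 : Form1 (d + 1) ℝ) := by
      funext κ₁ y
      exact hnull (Sum.inl κ₁) y
    rw [e, slotPsiS_zero]
    rfl
  · rw [exitRow_current_transport_inr_inl hn hr hS hδs hfb hgb hf hg ν β m v]
    exact hnull (Sum.inr m) v

/-- NOT IN PRINT; OUR BOOKKEEPING ([folklore]).  **WEIGHTED LEG FIRST, FREE LEG SECOND, for a LEG-SYMMETRIC local `S`**: under the same null hypothesis (free leg first),
`Σ'_q f(q_β)·Σ'_u g(u_ν)·(𝒯S) ν u q v (inl β) a = 0` for every free leg `(v, a)` (§2 `transport_symm` ⨾ the first form). -/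
theorem exitRow_current_transport_eq_zero_snd (hS : LocStencil S Cs δs) (hδs : 0 < δs)
    (hsym : ∀ (κ : Fin (d + 1)) (u x z : Site (d + 1)) (a b : Fib d), S κ u z x b a = S κ u x z a b)
    {f g : ℤ → ℝ} {Bf Bg : ℝ} (hfb : ∀ k, |f k| ≤ Bf) (hgb : ∀ k, |g k| ≤ Bg)
    (hf : ∀ k, f k ≠ 0 → k % (n : ℤ) = (n : ℤ) - 1) (hg : ∀ k, g k ≠ 0 → k % (n : ℤ) = (n : ℤ) - 1) (ν β : Fin (d + 1))
    (hnull : ∀ (a : Fib d) (v : Site (d + 1)), ∑' q : Site (d + 1), f (q β) * ∑' u : Site (d + 1), g (u ν) * S ν u v q a (Sum.inl β) = 0)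
    (a : Fib d) (v : Site (d + 1)) :
    ∑' q : Site (d + 1), f (q β) * ∑' u : Site (d + 1), g (u ν) * comp (comp (trK (psiKS r n)) (slotPsiS r n S ν u)) (psiKS r n) q v (Sum.inl β) a = 0 := by
  have e : ∀ (u q : Site (d + 1)), comp (comp (trK (psiKS r n)) (slotPsiS r n S ν u)) (psiKS r n) q v (Sum.inl β) a
      = comp (comp (trK (psiKS r n)) (slotPsiS r n S ν u)) (psiKS r n) v q a (Sum.inl β) := fun u q => transport_symm hn hr hS hδs hsym ν u v q a (Sum.inl β)
  simp_rw [e]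
  exact exitRow_current_transport_eq_zero_fst hn hr hS hδs hfb hgb hf hg ν β hnull a v

end Null

end Summit.QuantumFields.BalabanUV.Beta.GAN24.TransportedMixedLegCurrents

end
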